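import Literature.AlgebraicGeometry.ShimuraVarieties.UnitaryAuxiliaryTorusDatum
import Literature.AlgebraicGeometry.ShimuraVarieties.UnitaryShimuraCanonicalModelArtin
import Literature.NumberTheory.NumberFields.IdelicArtinMapRestriction
import HarnessLib

/-!
# Reflex transport in degree one: `E♯`-idèle Artin correspondents from `L`-idèle ones when `E♯ = τ(L)`
# (support stub T = ref2 glue g8 of the line `HeckeQuotient`, [Milne2005ShimuraVarieties] (59), Rem. 12.9)

Topic `AlgebraicGeometry/ShimuraVarieties`; namespace
`Literature.AlgebraicGeometry.ShimuraVarieties.UnitaryCanonicalModel.Aux` (the auxiliary datum of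
`UnitaryAuxiliaryTorusDatum`).  THEOREMS ONLY (no definition, no named fact, no instance; D-0014).  Cell
hodgecm-mathlib, fan B, rung B-I, KEY `b1-reflex-transport` (skeleton `B1HeckeQuotientDescent` v5 §7, support stub
`stub_reflexTransport : StubReflexTransport`).  HC_CM is proved only modulo the 7 printed citations until rung 0
closes; nothing here changes that.

## The statement (`exists_finiteIdele_norm_eq_isArtinCorrespondent_of_hasSmallReflex`, the stub VERBATIM)

Let `L` be a CM field, `Φ` a CM type, `τ : L →+* ℂ`, and suppose the reflex field is SMALL
(`Aux.HasSmallReflex L Φ τ`: `E*(Φ) ⊆ τ(L)`, so `E♯ := Aux.reflexField L Φ τ = τ(L)` and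
`Aux.toReflexField L Φ τ : L →+* E♯` is a bijection through which `E♯` is an `L`-algebra of degree one).  Then for
every `σ ∈ Aut(ℂ)` and every finite idèle `s` of `L` that is an Artin correspondent of `σ`
(`UnitaryCanonicalModel.IsArtinCorrespondent L τ s σ`: `σ|_{L̄} = γ` along some `L`-embedding `e : L̄ → ℂ` with
`[γ] = θ_L((1_∞, s))⁻¹` in `Gal(L̄/L)^ab`, [Milne2005ShimuraVarieties] (59)) there is a finite idèle `s♯` of `E♯` with
`N_{E♯/L} s♯ = s` (`AdelicBaseChange.finiteIdeleRelNorm`) which is an Artin correspondent of the same `σ` over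
`E♯ ⊂ ℂ`.

## Proof (transport of structure along the degree-one extension `τ : L ≅ E♯`, through the tree's functoriality)

* NORM: `s♯ := con_{E♯/L}(s)` (the packet's `FiniteAdeleRing.mapSemialgHom`); `N(con s) = s ^ [E♯ : L] = s`
  (`AdelicBaseChange.finiteAdeleRelNorm_mapSemialgHom`, Cassels–Fröhlich II (19.11)) since `[E♯ : L] = 1`.
* GALOIS: for an algebraic `K'/K` whose structure map is onto (degree one) the tree's fixed embedding
  `ι : K̄ → K̄'` (`absClosureEmbedding`) is bijective and the restriction `res : Γ_{K'} → Γ_K` (`absGaloisRestrict`)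
  is a bijection (`absGaloisRestrict_surjective_of_surjective`; injective by the tree's `absGaloisRestrict_injective`),
  so `res^ab : Γ_{K'}^ab → Γ_K^ab` (`absGaloisRestrictAb`) is injective (`absGaloisRestrictAb_injective_of_bijective`:
  a continuous bijection of profinite groups is a homeomorphism and carries the closed commutator subgroup onto the
  closed commutator subgroup).  Take `γ♯ := res⁻¹(γ)` and `e♯ := e ∘ ι⁻¹`; then `σ|_{Ē♯} = γ♯` along `e♯`.
* ARTIN: by injectivity of `res^ab` it suffices to compare in `Γ_L^ab`: `res^ab[γ♯] = [γ] = θ_L((1,s))⁻¹`, while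
  `res^ab θ_{E♯}((1, s♯)) = θ_L(N_{E♯/L}(1, s♯))` is THE ARTIN MAP COMMUTES WITH RESTRICTION AND NORM
  (`NumberFields.absGaloisRestrictAb_ideleArtinMap`, Tate VII Prop. 4.3 in the limit) and `θ_L` of a totally complex
  field only sees the finite part (`NumberFields.ideleArtinMap_eq_of_snd_eq`), which is `N s♯ = s`.

NOT the general-degree statement (for `[E♯ : τL] > 1` the norm is not onto; the line card's T⁺ is needed instead).

## References
* [Milne2005ShimuraVarieties] J. S. Milne, *Introduction to Shimura varieties* (2005), (59) p. 107; Rem. 12.9 p. 115.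
* [CasselsFrohlichANT1967] J. W. S. Cassels, A. Fröhlich (eds.), *Algebraic Number Theory* (1967): Ch. II §19
  (19.11); Ch. VII (Tate) Prop. 4.3, §5.4–5.6.
* [Liu2021] Y. Liu, *Fourier–Jacobi cycles and arithmetic relative trace formula*, Camb. J. Math. 9 (2021), App. C
  Rem. C.15 (p. 113).
-/

set_option autoImplicit false

noncomputable section

open Function NumberField Field IsDedekindDomain
open Literature.AlgebraicGeometry.Motives
open Literature.NumberTheory.GaloisRepresentations Literature.NumberTheory.NumberFields
open Literature.NumberTheory.AdelicBaseChange (finiteIdeleRelNorm finiteAdeleRelNorm ideleRelNorm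
  finiteAdeleRelNorm_mapSemialgHom coe_finiteIdeleRelNorm val_ideleRelNorm_snd)

namespace Literature.AlgebraicGeometry.ShimuraVarieties

namespace UnitaryCanonicalModel

namespace Aux

/-! ### §1. Degree-one extensions: `K̄ ≅ K̄'`, `Γ_{K'} ≅ Γ_K`, and `Γ_{K'}^ab ↪ Γ_K^ab` -/

section DegreeOne

variable (K K' : Type*) [Field K] [Field K'] [Algebra K K']

/-- For an ALGEBRAIC extension `K'/K` the tree's fixed `K`-embedding of algebraic closures
`ι = absClosureEmbedding K K' : K̄ → K̄'` is bijective (`K̄'` is algebraic over the algebraically closed `ι(K̄)`;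
the argument of the tree's `absGaloisRestrict_injective`). [cite: MilneFT2022, Ch. 7 (the absolute Galois group; restriction maps)] -/
theorem absClosureEmbedding_bijective [Algebra.IsAlgebraic K K'] :
    Function.Bijective (absClosureEmbedding K K') := by
  letI : Algebra (AlgebraicClosure K) (AlgebraicClosure K') := absClosureAlgebra K K'
  haveI := absClosure_isScalarTower K K'
  haveI : Algebra.IsAlgebraic (AlgebraicClosure K) (AlgebraicClosure K') :=
    Algebra.IsAlgebraic.tower_top (K := K) (AlgebraicClosure K)
  exact IsAlgClosed.algebraMap_bijective_of_isIntegral (k := AlgebraicClosure K) (K := AlgebraicClosure K')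

/-- **Degree one: the restriction `Γ_{K'} → Γ_K` is onto.**  If the structure map `K → K'` is surjective (an
isomorphism of fields), every `γ ∈ Gal(K̄/K)` is the restriction of the `K'`-automorphism `ι ∘ γ ∘ ι⁻¹` of `K̄'`
(`ι : K̄ ≅ K̄'` the fixed embedding, bijective by `absClosureEmbedding_bijective`; it is `K'`-linear because
`K' = K`). [cite: MilneFT2022, Ch. 7 (the absolute Galois group; restriction maps)] -/
theorem absGaloisRestrict_surjective_of_surjective (hK : Function.Surjective (algebraMap K K')) :
    Function.Surjective (absGaloisRestrict K K') := by
  intro γ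
  haveI : Module.Finite K K' := Module.Finite.of_surjective (Algebra.linearMap K K') hK
  haveI : Algebra.IsAlgebraic K K' := Algebra.IsAlgebraic.of_finite K K'
  let ιe : AlgebraicClosure K ≃ₐ[K] AlgebraicClosure K' :=
    AlgEquiv.ofBijective (absClosureEmbedding K K') (absClosureEmbedding_bijective K K')
  have hιe : ∀ x, ιe x = absClosureEmbedding K K' x := fun _ => rfl
  -- the transported automorphism `ι ∘ γ ∘ ι⁻¹`
  let g : AlgebraicClosure K' ≃+* AlgebraicClosure K' :=
    (ιe.symm.toRingEquiv.trans (absoluteGaloisGroup.toAlgEquiv K γ).toRingEquiv).trans ιe.toRingEquiv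
  have hg_apply : ∀ z, g z = ιe (absoluteGaloisGroup.toAlgEquiv K γ (ιe.symm z)) := fun _ => rfl
  have hg : ∀ x : K', g (algebraMap K' (AlgebraicClosure K') x) = algebraMap K' (AlgebraicClosure K') x := by
    intro x
    obtain ⟨k, rfl⟩ := hK x
    rw [← IsScalarTower.algebraMap_apply K K' (AlgebraicClosure K') k, hg_apply, ιe.symm.commutes,
      AlgEquiv.commutes, ιe.commutes]
  let γ' : absoluteGaloisGroup K' := (absoluteGaloisGroup.toAlgEquiv K').symm (AlgEquiv.ofRingEquiv (f := g) hg)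
  have hγ' : ∀ z, γ' • z = g z := fun _ => rfl
  refine ⟨γ', FaithfulSMul.eq_of_smul_eq_smul (α := AlgebraicClosure K) fun x => ?_⟩
  apply (absClosureEmbedding K K').toRingHom.injective
  change absClosureEmbedding K K' (absGaloisRestrict K K' γ' • x) = absClosureEmbedding K K' (γ • x)
  rw [absGaloisRestrict_apply_smul, hγ', hg_apply, ← hιe, ← hιe, ιe.symm_apply_apply]
  rfl

/-- **Degree one: `res^ab : Γ_{K'}^ab → Γ_K^ab` is injective when `res : Γ_{K'} → Γ_K` is bijective.**  A continuous
bijection of the profinite groups `Γ_{K'} → Γ_K` is a homeomorphism (compact to Hausdorff), and its inverse, a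
continuous group isomorphism, carries `[Γ_K, Γ_K]` into `[Γ_{K'}, Γ_{K'}]` and closures into closures; so
`res g ∈ closure [Γ_K, Γ_K]` forces `g ∈ closure [Γ_{K'}, Γ_{K'}]`. [cite: CasselsFrohlichANT1967, Ch. VI §2.4 (the map `G_{K'}^{ab} → G_K^{ab}`)] -/
theorem absGaloisRestrictAb_injective_of_bijective [CharZero K'] (h : Function.Bijective (absGaloisRestrict K K')) :
    Function.Injective (absGaloisRestrictAb K K') := by
  let ρ : absoluteGaloisGroup K' ≃* absoluteGaloisGroup K := MulEquiv.ofBijective (absGaloisRestrict K K') h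
  have hρ : Continuous ρ := (absGaloisRestrict K K').continuous
  have hρ' : Continuous ρ.symm := (hρ.homeoOfEquivCompactToT2 (f := ρ.toEquiv)).symm.continuous
  rw [injective_iff_map_eq_one]
  intro q hq
  obtain ⟨g, rfl⟩ := QuotientGroup.mk_surjective q
  have hq' : absGaloisRestrict K K' g ∈ (commutator (absoluteGaloisGroup K)).topologicalClosure := by
    rw [← QuotientGroup.eq_one_iff]
    exact hq
  rw [QuotientGroup.eq_one_iff]
  -- `ρ⁻¹ [Γ_K, Γ_K] ⊆ [Γ_{K'}, Γ_{K'}]`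
  have hle : ρ.symm '' (commutator (absoluteGaloisGroup K) : Set (absoluteGaloisGroup K)) ⊆
      (commutator (absoluteGaloisGroup K') : Set (absoluteGaloisGroup K')) := by
    rintro _ ⟨x, hx, rfl⟩
    have hmap : (commutator (absoluteGaloisGroup K)).map ρ.symm.toMonoidHom ≤ commutator (absoluteGaloisGroup K') := by
      rw [commutator, Subgroup.map_commutator]
      exact Subgroup.commutator_mono le_top le_top
    exact hmap ⟨x, hx, rfl⟩
  -- `g = ρ⁻¹ (res g) ∈ ρ⁻¹ (closure [Γ_K, Γ_K]) ⊆ closure (ρ⁻¹ [Γ_K, Γ_K]) ⊆ closure [Γ_{K'}, Γ_{K'}]`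
  have hmem : g ∈ ρ.symm '' closure (commutator (absoluteGaloisGroup K) : Set (absoluteGaloisGroup K)) :=
    ⟨absGaloisRestrict K K' g, hq', ρ.symm_apply_apply g⟩
  have h2 := closure_mono hle (image_closure_subset_closure_image hρ' hmem)
  rwa [← Subgroup.topologicalClosure_coe] at h2

end DegreeOne

/-! ### §2. The norm in degree one: `N_{K'/K}(con s) = s` -/

section Norm

variable (K K' : Type) [Field K] [NumberField K] [Field K'] [NumberField K'] [Algebra K K']

/-- **Degree one: the conorm is a section of the norm on finite idèles** — `N_{K'/K}(con_{K'/K} s) = s ^ [K':K] = s`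
for `[K' : K] = 1` ([CasselsFrohlichANT1967] II (19.11) `N(con α) = α^n`, the packet's
`finiteAdeleRelNorm_mapSemialgHom`). [cite: CasselsFrohlichANT1967, Ch. II §19 (19.11)] -/
theorem finiteIdeleRelNorm_map_mapSemialgHom_of_finrank_eq_one (h1 : Module.finrank K K' = 1)
    (s : (FiniteAdeleRing (𝓞 K) K)ˣ) :
    finiteIdeleRelNorm K K'
        (Units.map (FiniteAdeleRing.mapSemialgHom (𝓞 K) K K' (𝓞 K') :
          FiniteAdeleRing (𝓞 K) K →* FiniteAdeleRing (𝓞 K') K') s) = s :=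
  Units.ext (by
    rw [coe_finiteIdeleRelNorm, Units.coe_map, MonoidHom.coe_coe, finiteAdeleRelNorm_mapSemialgHom, h1, pow_one])

end Norm

/-! ### §3. The support stub T: reflex transport in degree one -/

/-- **Reflex transport, degree one (support stub T = ref2 glue g8 of the line `HeckeQuotient`)**: if `E*(Φ) ⊆ τ(L)`
(`Aux.HasSmallReflex`, so `τ : L ≅ E♯ = Aux.reflexField L Φ τ`), every finite idèle `s` of the CM field `L` that is an
Artin correspondent of `σ ∈ Aut(ℂ)` along `τ` ([Milne2005ShimuraVarieties] (59): `art_L(s) = σ|_{L^ab}` in the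
arithmetic normalisation of the tree's `θ_L`) is the norm `N_{E♯/L} s♯` of a finite idèle `s♯` of `E♯` (namely
`s♯ = con_{E♯/L} s`) which is an Artin correspondent of the same `σ` over `E♯ ⊂ ℂ`.  Transport of structure along
the degree-one extension `L → E♯`: `N(con s) = s` (§2); `σ|_{Ē♯} = ι γ ι⁻¹` along `e ∘ ι⁻¹` (§1); and in `Γ_L^ab`,
where `res^ab` is injective (§1), `res^ab θ_{E♯}((1, s♯)) = θ_L(N(1, s♯)) = θ_L((1, s))` by the norm functoriality of
the Artin map (`NumberFields.absGaloisRestrictAb_ideleArtinMap`, Tate VII 4.3) and `θ_L`'s blindness to the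
archimedean part of an idèle of the totally complex `L` (`NumberFields.ideleArtinMap_eq_of_snd_eq`).  The statement is
VERBATIM the skeleton's `StubReflexTransport` (instances `numberField_reflexField`, `toReflexField.toAlgebra`).
[cite: Milne2005ShimuraVarieties, (59) p. 107; Rem. 12.9 p. 115] [cite: CasselsFrohlichANT1967, Ch. VII Prop. 4.3]
[cite: Liu2021, App. C Rem. C.15 (p. 113)] -/
theorem exists_finiteIdele_norm_eq_isArtinCorrespondent_of_hasSmallReflex
    (L : Type) [Field L] [NumberField L] [IsCMField L] (Φ : CMType L) (τ : L →+* ℂ)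
    (hsm : Aux.HasSmallReflex L Φ τ) :
    (haveI : NumberField ↥(Aux.reflexField L Φ τ) := Aux.numberField_reflexField L Φ τ
     letI : Algebra L ↥(Aux.reflexField L Φ τ) := (Aux.toReflexField L Φ τ).toAlgebra
     ∀ (σ : ℂ ≃+* ℂ) (s : (FiniteAdeleRing (𝓞 L) L)ˣ), UnitaryCanonicalModel.IsArtinCorrespondent L τ s σ →
       ∃ s' : (FiniteAdeleRing (𝓞 ↥(Aux.reflexField L Φ τ)) ↥(Aux.reflexField L Φ τ))ˣ,
         finiteIdeleRelNorm L ↥(Aux.reflexField L Φ τ) s' = s ∧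
         UnitaryCanonicalModel.IsArtinCorrespondent ↥(Aux.reflexField L Φ τ)
           (algebraMap ↥(Aux.reflexField L Φ τ) ℂ) s' σ) := by
  intro σ s h
  haveI : NumberField ↥(reflexField L Φ τ) := numberField_reflexField L Φ τ
  letI : Algebra L ↥(reflexField L Φ τ) := (toReflexField L Φ τ).toAlgebra
  -- (1) degree one: `τ : L → E♯` is onto, `[E♯ : L] = 1`
  have hφ : Function.Surjective (algebraMap L ↥(reflexField L Φ τ)) := by
    intro x
    have hx : (x : ℂ) ∈ τ.toRatAlgHom.fieldRange := by
      rw [← reflexField_eq_of_hasSmallReflex L hsm]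
      exact x.2
    obtain ⟨l, hl⟩ := AlgHom.mem_fieldRange.1 hx
    exact ⟨l, Subtype.ext hl⟩
  have h1 : Module.finrank L ↥(reflexField L Φ τ) = 1 := by
    rw [← (AlgEquiv.ofBijective (Algebra.ofId L ↥(reflexField L Φ τ))
      ⟨(algebraMap L ↥(reflexField L Φ τ)).injective, hφ⟩).toLinearEquiv.finrank_eq, Module.finrank_self]
  haveI : Module.Finite L ↥(reflexField L Φ τ) := Module.Finite.of_surjective (Algebra.linearMap L _) hφ
  haveI : Algebra.IsAlgebraic L ↥(reflexField L Φ τ) := Algebra.IsAlgebraic.of_finite L _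
  -- (2) the conorm `s♯ := con s` and `N s♯ = s`
  let s' : (FiniteAdeleRing (𝓞 ↥(reflexField L Φ τ)) ↥(reflexField L Φ τ))ˣ :=
    Units.map (FiniteAdeleRing.mapSemialgHom (𝓞 L) L ↥(reflexField L Φ τ) (𝓞 ↥(reflexField L Φ τ)) :
      FiniteAdeleRing (𝓞 L) L →* FiniteAdeleRing (𝓞 ↥(reflexField L Φ τ)) ↥(reflexField L Φ τ)) s
  have hs' : finiteIdeleRelNorm L ↥(reflexField L Φ τ) s' = s :=
    finiteIdeleRelNorm_map_mapSemialgHom_of_finrank_eq_one L ↥(reflexField L Φ τ) h1 s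
  -- (3) the Galois data of the hypothesis
  letI : Algebra L ℂ := τ.toAlgebra
  obtain ⟨e, γ, he, hγ⟩ := h
  -- (4) `γ♯ := res⁻¹ γ`, `ι : L̄ ≅ Ē♯`
  have hres : Function.Bijective (absGaloisRestrict L ↥(reflexField L Φ τ)) :=
    ⟨absGaloisRestrict_injective L _, absGaloisRestrict_surjective_of_surjective L _ hφ⟩
  obtain ⟨γ', hγ'⟩ := hres.2 γ
  let ιe : AlgebraicClosure L ≃ₐ[L] AlgebraicClosure ↥(reflexField L Φ τ) :=
    AlgEquiv.ofBijective (absClosureEmbedding L _) (absClosureEmbedding_bijective L _)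
  have hιe : ∀ x, ιe x = absClosureEmbedding L ↥(reflexField L Φ τ) x := fun _ => rfl
  have hsmul : ∀ x, γ' • ιe x = ιe (γ • x) := fun x => by
    rw [hιe, hιe, ← absGaloisRestrict_apply_smul, hγ']
  -- (5) `e♯ := e ∘ ι⁻¹`, an `E♯`-embedding `Ē♯ → ℂ`
  letI : Algebra ↥(reflexField L Φ τ) ℂ := (algebraMap ↥(reflexField L Φ τ) ℂ).toAlgebra
  let e' : AlgebraicClosure ↥(reflexField L Φ τ) →ₐ[↥(reflexField L Φ τ)] ℂ :=
    { toRingHom := e.toRingHom.comp ιe.symm.toRingEquiv.toRingHom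
      commutes' := by
        intro x
        obtain ⟨l, rfl⟩ := hφ x
        change e (ιe.symm (algebraMap ↥(reflexField L Φ τ) (AlgebraicClosure ↥(reflexField L Φ τ))
          (algebraMap L ↥(reflexField L Φ τ) l))) = _
        rw [← IsScalarTower.algebraMap_apply L ↥(reflexField L Φ τ) (AlgebraicClosure ↥(reflexField L Φ τ)) l,
          ιe.symm.commutes, e.commutes]
        rfl }
  have he' : ∀ z, e' z = e (ιe.symm z) := fun _ => rfl
  refine ⟨s', hs', e', γ', fun z => ?_, ?_⟩
  · -- `σ|_{Ē♯} = γ♯` along `e♯`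
    obtain ⟨x, rfl⟩ := ιe.surjective z
    change e' (γ' • ιe x) = σ (e' (ιe x))
    rw [hsmul, he', he', ιe.symm_apply_apply, ιe.symm_apply_apply]
    exact he x
  · -- the Artin relation, compared in `Γ_L^ab` through the injective `res^ab`
    apply absGaloisRestrictAb_injective_of_bijective L ↥(reflexField L Φ τ) hres
    rw [absGaloisRestrictAb_mk, hγ', hγ, map_inv, inv_inj, finiteIdeleClass, finiteIdeleClass,
      ← ideleArtinMap_apply, ← ideleArtinMap_apply, absGaloisRestrictAb_ideleArtinMap]
    refine ideleArtinMap_eq_of_snd_eq ?_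
    rw [val_ideleRelNorm_snd, Units.coe_map, Units.coe_map, MonoidHom.inr_apply, MonoidHom.inr_apply]
    change (s : FiniteAdeleRing (𝓞 L) L) = finiteAdeleRelNorm L ↥(reflexField L Φ τ) (s' : FiniteAdeleRing _ _)
    rw [← coe_finiteIdeleRelNorm, hs']

end Aux

end UnitaryCanonicalModel

end Literature.AlgebraicGeometry.ShimuraVarieties

end
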